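import Summits.ValiantsHypothesis.ValiantsHypothesis.Theses.MonotoneRestoration
import Summits.ValiantsHypothesis.ValiantsHypothesis.Theorems.MonotoneRestorationOrbitCut
import Summits.ValiantsHypothesis.ValiantsHypothesis.Theorems.MonotoneRestorationCruxToTarget
import Summits.ValiantsHypothesis.ValiantsHypothesis.Theorems.MonotoneRestorationTargetImpliesCrux
import Summits.ValiantsHypothesis.ValiantsHypothesis.Theorems.MonotoneRestorationSensitiveBridge
import Summits.ValiantsHypothesis.ValiantsHypothesis.Theorems.MonotoneRestorationDenseSubtraction

/-!
# `NonnegRestorationQP` (stmt-ValiantsHypothesis-16191) is, by name, `OrbitRestorationQP ∧ OrbitCompressionQP`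

Line `orbit_cut` of the derived node `NonnegRestorationQP` (skeleton `Cruxes/NonnegRestorationQP/Lines/orbit_cut.lean`,
registered 17702cd1e983eacc) has exactly two stubs, and both are EXISTING route declarations stated by name:
`stub_orbitRestoration = OrbitRestorationQP` (stmt-18293, the route's crux) and
`stub_orbitCompression = OrbitCompressionQP` (stmt-18332, the banked aside).  This file records, kernel-checked and
in ONE declaration, that the item is not merely implied by but EQUIVALENT to the conjunction of those two items:

* `nonnegRestorationQP_of_orbitCut_stubs` — the skeleton's composition `NonnegRestorationQP_of` with the two stubs as
  hypotheses (landed `OrbitCut` ∘ `CruxToTarget` with the landed bridges `SensitiveBridge`, `DenseSubtraction`);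
* `orbitRestorationQP_of_nonnegRestorationQP`, `orbitCompressionQP_of_nonnegRestorationQP` — the converses
  (landed `stub_target_implies_crux` and THEOREM ε `monotoneRestorationQP_iff_complexRestorationQP`: a square-symmetric
  circuit of quasi-polynomial SIZE has quasi-polynomial ORBIT size, `LabelledArithCircuit.orbitSize_le_size`);
* `nonnegRestorationQP_iff_orbitCut` — `NonnegRestorationQP ↔ (OrbitRestorationQP ∧ OrbitCompressionQP)`.

Consequence for the census: closing BOTH registered stubs of line `orbit_cut` is necessary as well as sufficient for
the item; no proof of stmt-16191 avoids stmt-18293 (which alone implies `ValiantsHypothesis` by the route's `closes`).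
Honest label: by-name bookkeeping over landed theorems; no stub is closed; VP ≠ VNP is not touched.
-/

noncomputable section

-- the summit and the problem share the name `ValiantsHypothesis` (D-0017 single-conjunct layout)
set_option linter.dupNamespace false

namespace Summit.ValiantsHypothesis.ValiantsHypothesis.Theorems.NonnegRestorationQPOrbitCut

open Summit.ValiantsHypothesis.ValiantsHypothesis.Theses.MonotoneRestoration
open Literature.Computability.AlgebraicComplexity

/-- **The skeleton composition with its two stubs as hypotheses** (`NonnegRestorationQP_of` of line `orbit_cut`):
`OrbitRestorationQP → OrbitCompressionQP → NonnegRestorationQP`, through the landed `OrbitCut`, `CruxToTarget`,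
`SensitiveBridge`, `DenseSubtraction`. [folklore] -/
theorem nonnegRestorationQP_of_orbitCut_stubs (h₁ : OrbitRestorationQP) (h₂ : OrbitCompressionQP) :
    NonnegRestorationQP :=
  Summit.ValiantsHypothesis.ValiantsHypothesis.Theorems.monotoneRestoration_cruxToTarget_proof
    (Summit.ValiantsHypothesis.ValiantsHypothesis.Theorems.MonotoneRestoration.orbitCut_proof h₁ h₂)
    Summit.ValiantsHypothesis.ValiantsHypothesis.Theorems.MonotoneRestorationSensitive.sensitiveBridge_proof
    Summit.ValiantsHypothesis.ValiantsHypothesis.Theorems.denseSubtraction_proof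

/-- The complex form of the target: `NonnegRestorationQP` gives square-symmetric circuits of quasi-polynomial SIZE
for every matrix-symmetric `VP` family over `ℂ` (landed `stub_target_implies_crux` followed by THEOREM ε).
[folklore] -/
theorem complexRestoration_of_nonnegRestorationQP (h : NonnegRestorationQP) :
    ∀ f : (n : ℕ) → MvPolynomial (Fin n × Fin n) ℂ,
      (∀ (n : ℕ) (σ τ : Equiv.Perm (Fin n)),
        MvPolynomial.rename (fun p : Fin n × Fin n => (σ p.1, τ p.2)) (f n) = f n) →
      IsVPFamily f →
      ∃ c : ℕ, ∀ n : ℕ, ∃ (G : Type) (_ : Fintype G)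
        (C : LabelledArithCircuit ℂ (Fin n × Fin n) Unit G),
        C.IsSymmetric (Equiv.Perm (Fin n)) ∧ C.eval (C.output ()) = f n ∧
          Fintype.card G ≤ 2 ^ ((Nat.log 2 n + c) ^ c) :=
  Summit.ValiantsHypothesis.ValiantsHypothesis.Theorems.monotoneRestorationQP_iff_complexRestorationQP.mp
    (Summit.ValiantsHypothesis.ValiantsHypothesis.Theorems.stub_target_implies_crux h)

/-- **Converse, first conjunct:** `NonnegRestorationQP → OrbitRestorationQP` (stmt-16191 ⇒ stmt-18293): a circuit of
quasi-polynomial size has quasi-polynomial orbit size (`orbitSize_le_size`). [folklore] -/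
theorem orbitRestorationQP_of_nonnegRestorationQP (h : NonnegRestorationQP) : OrbitRestorationQP := by
  intro f hs hVP
  obtain ⟨c, hc⟩ := complexRestoration_of_nonnegRestorationQP h f hs hVP
  refine ⟨c, fun n => ?_⟩
  obtain ⟨G, inst, C, hCs, hCe, hCc⟩ := hc n
  exact ⟨G, inst, C, hCs, hCe, (C.orbitSize_le_size (Equiv.Perm (Fin n))).trans hCc⟩

/-- **Converse, second conjunct:** `NonnegRestorationQP → OrbitCompressionQP` (stmt-16191 ⇒ stmt-18332): the size bound
holds outright, so the orbit hypothesis of `OrbitCompressionQP` is not even used. [folklore] -/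
theorem orbitCompressionQP_of_nonnegRestorationQP (h : NonnegRestorationQP) : OrbitCompressionQP :=
  fun f hs hVP _ => complexRestoration_of_nonnegRestorationQP h f hs hVP

/-- **`NonnegRestorationQP ↔ OrbitRestorationQP ∧ OrbitCompressionQP`** — the derived node stmt-16191 IS the conjunction
of the two route items its registered line `orbit_cut` names as stubs (stmt-18293, stmt-18332). [folklore] -/
theorem nonnegRestorationQP_iff_orbitCut :
    NonnegRestorationQP ↔ (OrbitRestorationQP ∧ OrbitCompressionQP) :=
  ⟨fun h => ⟨orbitRestorationQP_of_nonnegRestorationQP h, orbitCompressionQP_of_nonnegRestorationQP h⟩,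
    fun h => nonnegRestorationQP_of_orbitCut_stubs h.1 h.2⟩

end Summit.ValiantsHypothesis.ValiantsHypothesis.Theorems.NonnegRestorationQPOrbitCut

end
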